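import Summits.Ventures.LatticeQCDFlow.Exactness.Phi4PhaseLabelFlipRate
import Summits.Ventures.LatticeQCDFlow.Exactness.Phi4HMCCarreDuChamp
import Summits.Ventures.LatticeQCDFlow.Exactness.FlowSamplerTauIntFloor
import Summits.Ventures.LatticeQCDFlow.Exactness.IMHDirichletForm
import HarnessLib

/-!
# TUNNELLING EVENTS CERTIFY A FLOOR, II (HMC and flow arms): `τ_int(θ) ≥ Var(θ)/(2 r_flip) − ½`

HONEST FRAMING: exact (Metropolis-corrected) sampling algorithms for lattice gauge theory;
figures of merit are autocorrelation/cost numbers at stated couplings and volumes; no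
continuum-physics claim.  (SCALAR calibration rung S0-A: not a gauge result.)

Venture `LatticeQCDFlow` (cell pub-lqcd), topic `Exactness`; FANOUT row 2 (`s0-phi4`, HMC and FLOW
arms; the local arm and the shared lemmas `label_sq_sub_eq_four_mul_flip`, `gibbs_signM_var` are
`Exactness/Phi4PhaseLabelFlipRate.lean`).  NEW WORK of the cell, composing
`Phi4HMCCarreDuChamp.hmc_tauInt_ge_of_msd_le` (every HMC-type update: refresh, measurable
Lebesgue-preserving involution `Ψ`, Metropolis test) and `IMHDirichletForm.dirichlet_eq_half_sq` +
`FlowSamplerTauIntFloor.imhOp_tauInt_ge` (the flow sampler) with the remark that a `±1` label's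
squared jump is `4 ×` the indicator of a label change.  Nothing is cited as a fact; counting
tunnelling events as a mixing diagnostic is folklore of the lattice literature, named only.

## What is proved (`Λ = Fin (n+1)`, `λ > 0`, any `J`; `F` measurable, `c` a level, `θ = ±1` the
label of `{c ≤ F}`, `g = θ − ⟨θ⟩`, `Var(θ) = ⟨(θ − ⟨θ⟩)²⟩`, `χ_flip = 1` iff the labels differ)

* HMC arm (`K_Ψ = hmcOpOf J λ Ψ`; `r = ∫∫ a(z) χ_flip((Ψ z).1, z.1) e^{−H} / (Z_p Z)` the
  probability per update of an ACCEPTED label change): **`hmc_tauInt_ge_flipRate`** —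
  `τ_int(θ) ≥ Var(θ)/(2 r) − ½`; `hmcPhi4_tauInt_ge_flipRate` — row 2's qpq-leapfrog HMC, every
  `δ`, `N`; `hmcPhi4_tauInt_ge_signFlipRate` — `θ = sgn M`: `τ_int,traj(sgn M) ≥ 1/(2 r) − ½`;
* FLOW arm (`K = imhOpPhi4 J λ q̃`, every positive model density with `∫ q̃ = 1`;
  `r = Z⁻¹ ∫∫ min(e^{−S} q̃', e^{−S'} q̃) χ_flip`): **`phi4Flow_tauInt_ge_flipRate`** —
  `τ_int(θ) ≥ Var(θ)/(2 r) − ½`; `phi4Flow_tauInt_ge_signFlipRate` — `≥ 1/(2 r) − ½` for `sgn M`.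

Hypotheses (NOT discharged for any run): summable autocorrelation series and `ρ_g(1) < 1`.  Reading
(no numerics implied): `N` trajectories (flow steps) with `F` accepted sign changes of `M` cannot
certify `τ_int(sgn M) < N/(2F) − ½`; the same for any sector label with `Var(θ) = 4p(1 − p)`.  NOT
CLAIMED: any value of `r`; upper bounds; partial momentum refreshment.
-/

namespace Summit.Ventures.LatticeQCDFlow.Exactness

open Real MeasureTheory Filter Finset
open Summit.Ventures.LatticeQCDFlow.Scoring

section FlipRateHMCFlow

variable {n : ℕ}

/-! ## §3 HMC arm: the accepted flip rate per trajectory -/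

/-- **THE FLIP-RATE FLOOR FOR EVERY HMC-TYPE UPDATE.**  Every `λ > 0`, real `J`, measurable
Lebesgue-preserving involution `Ψ` of phase space (`K_Ψ = hmcOpOf J λ Ψ`: refresh, propose `Ψ`,
Metropolis test); `F` measurable, `c` a level, `θ = ±1` the label of `{c ≤ F}`, `g = θ − ⟨θ⟩`;
`r = ∫∫ a(z) χ_flip((Ψ z).1, z.1) e^{−H(z)} dz / (Z_p Z)` the equilibrium probability per update of an
ACCEPTED label change.  Summable series and `ρ_g(1) < 1` ⇒ `τ_int(θ) ≥ ⟨(θ − ⟨θ⟩)²⟩/(2 r) − ½`. -/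
theorem hmc_tauInt_ge_flipRate {lam : ℝ} (hlam : 0 < lam) (J : Fin (n + 1) → Fin (n + 1) → ℝ)
    {Ψ : (Fin (n + 1) → ℝ) × (Fin (n + 1) → ℝ) → (Fin (n + 1) → ℝ) × (Fin (n + 1) → ℝ)}
    (hΨm : Measurable Ψ) (hΨi : Function.Involutive Ψ)
    (hΨμ : MeasurePreserving Ψ ((volume : Measure (Fin (n + 1) → ℝ)).prod volume)
      ((volume : Measure (Fin (n + 1) → ℝ)).prod volume))
    {F : (Fin (n + 1) → ℝ) → ℝ} (hF : Measurable F) (c : ℝ)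
    (hs : Summable fun k => (∫ φ, ((if c ≤ F φ then (1 : ℝ) else -1)
          - gibbsExpect J lam (fun ψ => if c ≤ F ψ then (1 : ℝ) else -1))
        * ((hmcOpOf J lam Ψ)^[k + 1] (fun ψ => (if c ≤ F ψ then (1 : ℝ) else -1)
          - gibbsExpect J lam (fun ψ => if c ≤ F ψ then (1 : ℝ) else -1))) φ * gibbsWeight J lam φ)
        / ∫ φ, ((if c ≤ F φ then (1 : ℝ) else -1)
          - gibbsExpect J lam (fun ψ => if c ≤ F ψ then (1 : ℝ) else -1)) ^ 2 * gibbsWeight J lam φ)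
    (hρ : (∫ φ, ((if c ≤ F φ then (1 : ℝ) else -1)
          - gibbsExpect J lam (fun ψ => if c ≤ F ψ then (1 : ℝ) else -1))
        * hmcOpOf J lam Ψ (fun ψ => (if c ≤ F ψ then (1 : ℝ) else -1)
          - gibbsExpect J lam (fun ψ => if c ≤ F ψ then (1 : ℝ) else -1)) φ * gibbsWeight J lam φ)
        / (∫ φ, ((if c ≤ F φ then (1 : ℝ) else -1)
          - gibbsExpect J lam (fun ψ => if c ≤ F ψ then (1 : ℝ) else -1)) ^ 2 * gibbsWeight J lam φ)
        < 1) :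
    gibbsExpect J lam (fun φ => ((if c ≤ F φ then (1 : ℝ) else -1)
          - gibbsExpect J lam (fun ψ => if c ≤ F ψ then (1 : ℝ) else -1)) ^ 2)
        / (2 * ((∫ z, involAccept (phi4HmcEnergy J lam) Ψ z
            * (if (c ≤ F (Ψ z).1 ↔ c ≤ F z.1) then (0 : ℝ) else 1)
            * Real.exp (-phi4HmcEnergy J lam z) ∂((volume : Measure (Fin (n + 1) → ℝ)).prod volume))
          / (momentumZ n * gibbsZ J lam))) - 1 / 2
      ≤ tauInt (fun k => (∫ φ, ((if c ≤ F φ then (1 : ℝ) else -1)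
          - gibbsExpect J lam (fun ψ => if c ≤ F ψ then (1 : ℝ) else -1))
        * ((hmcOpOf J lam Ψ)^[k] (fun ψ => (if c ≤ F ψ then (1 : ℝ) else -1)
          - gibbsExpect J lam (fun ψ => if c ≤ F ψ then (1 : ℝ) else -1))) φ * gibbsWeight J lam φ)
        / ∫ φ, ((if c ≤ F φ then (1 : ℝ) else -1)
          - gibbsExpect J lam (fun ψ => if c ≤ F ψ then (1 : ℝ) else -1)) ^ 2 * gibbsWeight J lam φ) := by
  have hZ := gibbsZ_pos hlam J
  have hZp := momentumZ_pos n
  set I := ∫ z, involAccept (phi4HmcEnergy J lam) Ψ z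
      * (if (c ≤ F (Ψ z).1 ↔ c ≤ F z.1) then (0 : ℝ) else 1)
      * Real.exp (-phi4HmcEnergy J lam z) ∂((volume : Measure (Fin (n + 1) → ℝ)).prod volume) with hI
  -- the mean squared accepted jump of `θ` is `4 I`
  have hD : ∫ z, involAccept (phi4HmcEnergy J lam) Ψ z
      * ((if c ≤ F (Ψ z).1 then (1 : ℝ) else -1) - (if c ≤ F z.1 then (1 : ℝ) else -1)) ^ 2
      * Real.exp (-phi4HmcEnergy J lam z) ∂((volume : Measure (Fin (n + 1) → ℝ)).prod volume)
      ≤ (4 * (I / (momentumZ n * gibbsZ J lam))) * (momentumZ n * gibbsZ J lam) := by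
    rw [mul_assoc, div_mul_cancel₀ _ (mul_pos hZp hZ).ne', hI, ← integral_const_mul]
    refine le_of_eq (integral_congr_ae (Eventually.of_forall fun z => ?_))
    show involAccept (phi4HmcEnergy J lam) Ψ z
        * ((if c ≤ F (Ψ z).1 then (1 : ℝ) else -1) - (if c ≤ F z.1 then (1 : ℝ) else -1)) ^ 2
        * Real.exp (-phi4HmcEnergy J lam z)
      = 4 * (involAccept (phi4HmcEnergy J lam) Ψ z
        * (if (c ≤ F (Ψ z).1 ↔ c ≤ F z.1) then (0 : ℝ) else 1) * Real.exp (-phi4HmcEnergy J lam z))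
    rw [label_sq_sub_eq_four_mul_flip]
    ring
  have h := hmc_tauInt_ge_of_msd_le hlam J hΨm hΨi hΨμ (label_bddObs hF c) hD hs hρ
  have e : ∀ P r : ℝ, P / (2 * r) - 1 / 2 = 2 * P / (4 * r) - 1 / 2 := by
    intro P r
    rcases eq_or_ne r 0 with hr | hr
    · simp [hr]
    · congr 1
      field_simp
      ring
  rw [e]
  exact h

/-- **Row 2's HMC** (qpq leapfrog, every `δ`, `N`): `τ_int,traj(θ) ≥ Var(θ)/(2 r) − ½`, `r` the
probability per trajectory of an accepted label change. -/
theorem hmcPhi4_tauInt_ge_flipRate {lam : ℝ} (hlam : 0 < lam) (J : Fin (n + 1) → Fin (n + 1) → ℝ)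
    (δ : ℝ) (N : ℕ) {F : (Fin (n + 1) → ℝ) → ℝ} (hF : Measurable F) (c : ℝ)
    (hs : Summable fun k => (∫ φ, ((if c ≤ F φ then (1 : ℝ) else -1)
          - gibbsExpect J lam (fun ψ => if c ≤ F ψ then (1 : ℝ) else -1))
        * ((hmcOpPhi4 J lam δ N)^[k + 1] (fun ψ => (if c ≤ F ψ then (1 : ℝ) else -1)
          - gibbsExpect J lam (fun ψ => if c ≤ F ψ then (1 : ℝ) else -1))) φ * gibbsWeight J lam φ)
        / ∫ φ, ((if c ≤ F φ then (1 : ℝ) else -1)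
          - gibbsExpect J lam (fun ψ => if c ≤ F ψ then (1 : ℝ) else -1)) ^ 2 * gibbsWeight J lam φ)
    (hρ : (∫ φ, ((if c ≤ F φ then (1 : ℝ) else -1)
          - gibbsExpect J lam (fun ψ => if c ≤ F ψ then (1 : ℝ) else -1))
        * hmcOpPhi4 J lam δ N (fun ψ => (if c ≤ F ψ then (1 : ℝ) else -1)
          - gibbsExpect J lam (fun ψ => if c ≤ F ψ then (1 : ℝ) else -1)) φ * gibbsWeight J lam φ)
        / (∫ φ, ((if c ≤ F φ then (1 : ℝ) else -1)
          - gibbsExpect J lam (fun ψ => if c ≤ F ψ then (1 : ℝ) else -1)) ^ 2 * gibbsWeight J lam φ)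
        < 1) :
    gibbsExpect J lam (fun φ => ((if c ≤ F φ then (1 : ℝ) else -1)
          - gibbsExpect J lam (fun ψ => if c ≤ F ψ then (1 : ℝ) else -1)) ^ 2)
        / (2 * ((∫ z, involAccept (phi4HmcEnergy J lam) (hmcProposal J lam δ N) z
            * (if (c ≤ F (hmcProposal J lam δ N z).1 ↔ c ≤ F z.1) then (0 : ℝ) else 1)
            * Real.exp (-phi4HmcEnergy J lam z) ∂((volume : Measure (Fin (n + 1) → ℝ)).prod volume))
          / (momentumZ n * gibbsZ J lam))) - 1 / 2
      ≤ tauInt (fun k => (∫ φ, ((if c ≤ F φ then (1 : ℝ) else -1)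
          - gibbsExpect J lam (fun ψ => if c ≤ F ψ then (1 : ℝ) else -1))
        * ((hmcOpPhi4 J lam δ N)^[k] (fun ψ => (if c ≤ F ψ then (1 : ℝ) else -1)
          - gibbsExpect J lam (fun ψ => if c ≤ F ψ then (1 : ℝ) else -1))) φ * gibbsWeight J lam φ)
        / ∫ φ, ((if c ≤ F φ then (1 : ℝ) else -1)
          - gibbsExpect J lam (fun ψ => if c ≤ F ψ then (1 : ℝ) else -1)) ^ 2 * gibbsWeight J lam φ) :=
  hmc_tauInt_ge_flipRate hlam J (measurable_hmcProposal J lam δ N)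
    (hmcProposal_involutive J lam δ N) (measurePreserving_hmcProposal J lam δ N) hF c hs hρ

/-- **HMC arm, `θ = sgn M`: `τ_int,traj(sgn M) ≥ 1/(2 r) − ½`**, `r` the probability per trajectory
of an accepted change of the sign of the magnetisation (the "tunnelling-event rate"). -/
theorem hmcPhi4_tauInt_ge_signFlipRate {lam : ℝ} (hlam : 0 < lam) (J : Fin (n + 1) → Fin (n + 1) → ℝ)
    (δ : ℝ) (N : ℕ)
    (hs : Summable fun k => (∫ φ, ((if 0 ≤ ∑ x, φ x then (1 : ℝ) else -1)
          - gibbsExpect J lam (fun ψ => if 0 ≤ ∑ x, ψ x then (1 : ℝ) else -1))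
        * ((hmcOpPhi4 J lam δ N)^[k + 1] (fun ψ => (if 0 ≤ ∑ x, ψ x then (1 : ℝ) else -1)
          - gibbsExpect J lam (fun ψ => if 0 ≤ ∑ x, ψ x then (1 : ℝ) else -1))) φ * gibbsWeight J lam φ)
        / ∫ φ, ((if 0 ≤ ∑ x, φ x then (1 : ℝ) else -1)
          - gibbsExpect J lam (fun ψ => if 0 ≤ ∑ x, ψ x then (1 : ℝ) else -1)) ^ 2 * gibbsWeight J lam φ)
    (hρ : (∫ φ, ((if 0 ≤ ∑ x, φ x then (1 : ℝ) else -1)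
          - gibbsExpect J lam (fun ψ => if 0 ≤ ∑ x, ψ x then (1 : ℝ) else -1))
        * hmcOpPhi4 J lam δ N (fun ψ => (if 0 ≤ ∑ x, ψ x then (1 : ℝ) else -1)
          - gibbsExpect J lam (fun ψ => if 0 ≤ ∑ x, ψ x then (1 : ℝ) else -1)) φ * gibbsWeight J lam φ)
        / (∫ φ, ((if 0 ≤ ∑ x, φ x then (1 : ℝ) else -1)
          - gibbsExpect J lam (fun ψ => if 0 ≤ ∑ x, ψ x then (1 : ℝ) else -1)) ^ 2 * gibbsWeight J lam φ)
        < 1) :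
    1 / (2 * ((∫ z, involAccept (phi4HmcEnergy J lam) (hmcProposal J lam δ N) z
            * (if (0 ≤ ∑ x, (hmcProposal J lam δ N z).1 x ↔ 0 ≤ ∑ x, z.1 x) then (0 : ℝ) else 1)
            * Real.exp (-phi4HmcEnergy J lam z) ∂((volume : Measure (Fin (n + 1) → ℝ)).prod volume))
          / (momentumZ n * gibbsZ J lam))) - 1 / 2
      ≤ tauInt (fun k => (∫ φ, ((if 0 ≤ ∑ x, φ x then (1 : ℝ) else -1)
          - gibbsExpect J lam (fun ψ => if 0 ≤ ∑ x, ψ x then (1 : ℝ) else -1))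
        * ((hmcOpPhi4 J lam δ N)^[k] (fun ψ => (if 0 ≤ ∑ x, ψ x then (1 : ℝ) else -1)
          - gibbsExpect J lam (fun ψ => if 0 ≤ ∑ x, ψ x then (1 : ℝ) else -1))) φ * gibbsWeight J lam φ)
        / ∫ φ, ((if 0 ≤ ∑ x, φ x then (1 : ℝ) else -1)
          - gibbsExpect J lam (fun ψ => if 0 ≤ ∑ x, ψ x then (1 : ℝ) else -1)) ^ 2 * gibbsWeight J lam φ) := by
  have hMm : Measurable fun φ : Fin (n + 1) → ℝ => ∑ y, φ y :=
    Finset.measurable_sum _ fun y _ => measurable_pi_apply y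
  have h := hmcPhi4_tauInt_ge_flipRate hlam J δ N hMm 0 hs hρ
  rw [gibbs_signM_var hlam J] at h
  exact h

/-! ## §4 FLOW arm: the accepted flip rate per step -/

/-- **THE FLIP-RATE FLOOR OF THE FLOW SAMPLER.**  Every `λ > 0`, real `J`, positive measurable model
density `q̃` with `∫ q̃ = 1` (`K = imhOpPhi4 J λ q̃`); `F` measurable, `c` a level, `θ = ±1` the
label of `{c ≤ F}`, `g = θ − ⟨θ⟩`;
`r = Z⁻¹ ∫∫ min(e^{−S(φ)} q̃(φ'), e^{−S(φ')} q̃(φ)) χ_flip(φ, φ') dφ dφ'` the equilibrium probability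
per step of an accepted label change.  Summable series and `ρ_g(1) < 1` ⇒
`τ_int(θ) ≥ ⟨(θ − ⟨θ⟩)²⟩/(2 r) − ½`. -/
theorem phi4Flow_tauInt_ge_flipRate {lam : ℝ} (hlam : 0 < lam) (J : Fin (n + 1) → Fin (n + 1) → ℝ)
    {q : (Fin (n + 1) → ℝ) → ℝ} (hq0 : ∀ φ, 0 < q φ) (hqm : Measurable q) (hqi : Integrable q)
    (hq1 : ∫ φ, q φ = 1) {F : (Fin (n + 1) → ℝ) → ℝ} (hF : Measurable F) (c : ℝ)
    (hs : Summable fun k => (∫ φ, ((if c ≤ F φ then (1 : ℝ) else -1)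
          - gibbsExpect J lam (fun ψ => if c ≤ F ψ then (1 : ℝ) else -1))
        * ((imhOpPhi4 J lam q)^[k + 1] (fun ψ => (if c ≤ F ψ then (1 : ℝ) else -1)
          - gibbsExpect J lam (fun ψ => if c ≤ F ψ then (1 : ℝ) else -1))) φ * gibbsWeight J lam φ)
        / ∫ φ, ((if c ≤ F φ then (1 : ℝ) else -1)
          - gibbsExpect J lam (fun ψ => if c ≤ F ψ then (1 : ℝ) else -1)) ^ 2 * gibbsWeight J lam φ)
    (hρ : (∫ φ, ((if c ≤ F φ then (1 : ℝ) else -1)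
          - gibbsExpect J lam (fun ψ => if c ≤ F ψ then (1 : ℝ) else -1))
        * imhOpPhi4 J lam q (fun ψ => (if c ≤ F ψ then (1 : ℝ) else -1)
          - gibbsExpect J lam (fun ψ => if c ≤ F ψ then (1 : ℝ) else -1)) φ * gibbsWeight J lam φ)
        / (∫ φ, ((if c ≤ F φ then (1 : ℝ) else -1)
          - gibbsExpect J lam (fun ψ => if c ≤ F ψ then (1 : ℝ) else -1)) ^ 2 * gibbsWeight J lam φ)
        < 1) :
    gibbsExpect J lam (fun φ => ((if c ≤ F φ then (1 : ℝ) else -1)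
          - gibbsExpect J lam (fun ψ => if c ≤ F ψ then (1 : ℝ) else -1)) ^ 2)
        / (2 * ((∫ p, imhFlow (gibbsWeight J lam) q p.1 p.2
            * (if (c ≤ F p.1 ↔ c ≤ F p.2) then (0 : ℝ) else 1)
              ∂((volume : Measure (Fin (n + 1) → ℝ)).prod volume)) / gibbsZ J lam)) - 1 / 2
      ≤ tauInt (fun k => (∫ φ, ((if c ≤ F φ then (1 : ℝ) else -1)
          - gibbsExpect J lam (fun ψ => if c ≤ F ψ then (1 : ℝ) else -1))
        * ((imhOpPhi4 J lam q)^[k] (fun ψ => (if c ≤ F ψ then (1 : ℝ) else -1)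
          - gibbsExpect J lam (fun ψ => if c ≤ F ψ then (1 : ℝ) else -1))) φ * gibbsWeight J lam φ)
        / ∫ φ, ((if c ≤ F φ then (1 : ℝ) else -1)
          - gibbsExpect J lam (fun ψ => if c ≤ F ψ then (1 : ℝ) else -1)) ^ 2 * gibbsWeight J lam φ) := by
  have hZ := gibbsZ_pos hlam J
  have hwi := integrable_gibbsWeight hlam J
  have hw0 : ∀ φ : Fin (n + 1) → ℝ, 0 < gibbsWeight J lam φ := fun φ => gibbsWeight_pos J lam φ
  have hwm : Measurable (gibbsWeight J lam) := (continuous_gibbsWeight J lam).measurable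
  set a := gibbsExpect J lam (fun ψ : Fin (n + 1) → ℝ => if c ≤ F ψ then (1 : ℝ) else -1) with ha
  obtain ⟨hθm, B, hθb⟩ := label_bddObs hF c (n := n)
  obtain ⟨hgm, hgb, -⟩ := centred_observable hlam J hθm hθb
  rw [← ha] at hgm hgb
  rw [imhOpPhi4_eq_imhOp] at hs hρ ⊢
  have hfloor := imhOp_tauInt_ge (μ := volume) hw0 hwm hwi hq0 hqm hqi hq1 hgm hgb hs
  have hdir := dirichlet_eq_half_sq (μ := volume) hw0 hwm hwi hq0 hqm hqi hq1 hgm hgb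
  set P := ∫ φ, ((if c ≤ F φ then (1 : ℝ) else -1) - a) ^ 2 * gibbsWeight J lam φ with hP
  set C1 := ∫ φ, ((if c ≤ F φ then (1 : ℝ) else -1) - a)
      * imhOp volume (gibbsWeight J lam) q (fun ψ => (if c ≤ F ψ then (1 : ℝ) else -1) - a) φ
      * gibbsWeight J lam φ with hC1
  set R := ∫ p, imhFlow (gibbsWeight J lam) q p.1 p.2
      * (if (c ≤ F p.1 ↔ c ≤ F p.2) then (0 : ℝ) else 1)
        ∂((volume : Measure (Fin (n + 1) → ℝ)).prod volume) with hR
  -- the Dirichlet form is `2 R`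
  have hdir' : P - C1 = 2 * R := by
    rw [hdir, hR]
    have e : ∀ p : (Fin (n + 1) → ℝ) × (Fin (n + 1) → ℝ),
        imhFlow (gibbsWeight J lam) q p.1 p.2
          * (((if c ≤ F p.1 then (1 : ℝ) else -1) - a) - ((if c ≤ F p.2 then (1 : ℝ) else -1) - a)) ^ 2
        = 4 * (imhFlow (gibbsWeight J lam) q p.1 p.2
          * (if (c ≤ F p.1 ↔ c ≤ F p.2) then (0 : ℝ) else 1)) := by
      intro p
      have h4 := label_sq_sub_eq_four_mul_flip (c ≤ F p.1) (c ≤ F p.2)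
      have e1 : ((if c ≤ F p.1 then (1 : ℝ) else -1) - a) - ((if c ≤ F p.2 then (1 : ℝ) else -1) - a)
          = (if c ≤ F p.1 then (1 : ℝ) else -1) - (if c ≤ F p.2 then (1 : ℝ) else -1) := by ring
      rw [e1, h4]
      ring
    simp_rw [e]
    rw [integral_const_mul]
    ring
  have hP0 : 0 ≤ P := integral_nonneg fun φ => mul_nonneg (sq_nonneg _) (hw0 φ).le
  have hR0 : 0 ≤ R := by
    rw [hR]
    refine integral_nonneg fun p => mul_nonneg ?_ ?_
    · unfold imhFlow
      exact le_min (mul_nonneg (hw0 _).le (hq0 _).le) (mul_nonneg (hw0 _).le (hq0 _).le)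
    · split_ifs <;> norm_num
  -- bookkeeping: `⟨g²⟩/(2 (R/Z)) = P/(2R)`
  have e0 : (P / gibbsZ J lam) / (2 * (R / gibbsZ J lam)) - 1 / 2 = P / (2 * R) - 1 / 2 := by
    rcases eq_or_ne R 0 with hR0' | hRne
    · simp [hR0']
    · congr 1
      field_simp
  unfold gibbsExpect
  beta_reduce
  rw [e0]
  refine le_trans ?_ hfloor
  rcases eq_or_lt_of_le hP0 with hz | hPpos
  · -- degenerate `P = 0`: the left side is `−½ ≤` anything of the form `(1+x)/(2(1−x))` with `x < 1`
    have hx : C1 / P < 1 := hρ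
    rw [← hz] at hx ⊢
    simp only [zero_div, div_zero, zero_sub] at hx ⊢
    norm_num
  · have h1 : 1 - C1 / P ≤ 2 * R / P * (1 - 0) := by
      rw [sub_zero, mul_one]
      have e : 1 - C1 / P = (P - C1) / P := by field_simp
      rw [e, hdir']
    have ht := RevOp.floor_transfer hρ h1
    have e2 : 1 / (2 * R / P * (1 - (0 : ℝ))) = P / (2 * R) := by
      rw [sub_zero, mul_one, one_div_div]
    rw [e2] at ht
    exact ht

/-- **FLOW arm, `θ = sgn M`: `τ_int(sgn M) ≥ 1/(2 r) − ½`** for every model density, `r` the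
probability per step of an accepted change of the sign of the magnetisation. -/
theorem phi4Flow_tauInt_ge_signFlipRate {lam : ℝ} (hlam : 0 < lam) (J : Fin (n + 1) → Fin (n + 1) → ℝ)
    {q : (Fin (n + 1) → ℝ) → ℝ} (hq0 : ∀ φ, 0 < q φ) (hqm : Measurable q) (hqi : Integrable q)
    (hq1 : ∫ φ, q φ = 1)
    (hs : Summable fun k => (∫ φ, ((if 0 ≤ ∑ x, φ x then (1 : ℝ) else -1)
          - gibbsExpect J lam (fun ψ => if 0 ≤ ∑ x, ψ x then (1 : ℝ) else -1))
        * ((imhOpPhi4 J lam q)^[k + 1] (fun ψ => (if 0 ≤ ∑ x, ψ x then (1 : ℝ) else -1)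
          - gibbsExpect J lam (fun ψ => if 0 ≤ ∑ x, ψ x then (1 : ℝ) else -1))) φ * gibbsWeight J lam φ)
        / ∫ φ, ((if 0 ≤ ∑ x, φ x then (1 : ℝ) else -1)
          - gibbsExpect J lam (fun ψ => if 0 ≤ ∑ x, ψ x then (1 : ℝ) else -1)) ^ 2 * gibbsWeight J lam φ)
    (hρ : (∫ φ, ((if 0 ≤ ∑ x, φ x then (1 : ℝ) else -1)
          - gibbsExpect J lam (fun ψ => if 0 ≤ ∑ x, ψ x then (1 : ℝ) else -1))
        * imhOpPhi4 J lam q (fun ψ => (if 0 ≤ ∑ x, ψ x then (1 : ℝ) else -1)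
          - gibbsExpect J lam (fun ψ => if 0 ≤ ∑ x, ψ x then (1 : ℝ) else -1)) φ * gibbsWeight J lam φ)
        / (∫ φ, ((if 0 ≤ ∑ x, φ x then (1 : ℝ) else -1)
          - gibbsExpect J lam (fun ψ => if 0 ≤ ∑ x, ψ x then (1 : ℝ) else -1)) ^ 2 * gibbsWeight J lam φ)
        < 1) :
    1 / (2 * ((∫ p, imhFlow (gibbsWeight J lam) q p.1 p.2
            * (if (0 ≤ ∑ x, p.1 x ↔ 0 ≤ ∑ x, p.2 x) then (0 : ℝ) else 1)
              ∂((volume : Measure (Fin (n + 1) → ℝ)).prod volume)) / gibbsZ J lam)) - 1 / 2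
      ≤ tauInt (fun k => (∫ φ, ((if 0 ≤ ∑ x, φ x then (1 : ℝ) else -1)
          - gibbsExpect J lam (fun ψ => if 0 ≤ ∑ x, ψ x then (1 : ℝ) else -1))
        * ((imhOpPhi4 J lam q)^[k] (fun ψ => (if 0 ≤ ∑ x, ψ x then (1 : ℝ) else -1)
          - gibbsExpect J lam (fun ψ => if 0 ≤ ∑ x, ψ x then (1 : ℝ) else -1))) φ * gibbsWeight J lam φ)
        / ∫ φ, ((if 0 ≤ ∑ x, φ x then (1 : ℝ) else -1)
          - gibbsExpect J lam (fun ψ => if 0 ≤ ∑ x, ψ x then (1 : ℝ) else -1)) ^ 2 * gibbsWeight J lam φ) := by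
  have hMm : Measurable fun φ : Fin (n + 1) → ℝ => ∑ y, φ y :=
    Finset.measurable_sum _ fun y _ => measurable_pi_apply y
  have h := phi4Flow_tauInt_ge_flipRate hlam J hq0 hqm hqi hq1 hMm 0 hs hρ
  rw [gibbs_signM_var hlam J] at h
  exact h

end FlipRateHMCFlow

end Summit.Ventures.LatticeQCDFlow.Exactness
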